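import Literature.Topology.FourManifolds.BordismFourDisjointUnion
import Literature.Topology.FourManifolds.BordismTransitivity
import Literature.AlgebraicTopology.SingularHomology.WuClassesBoundary
import HarnessLib

/-!
# The Wu number `v₁⁴[M] ∈ ℤ/2` is an unoriented bordism invariant of closed 4-manifolds

R. Thom, *Quelques propriétés globales des variétés différentiables*, Comment. Math. Helv. 28
(1954): Thm. IV.3 (p. 66) "si deux variétés sont cobordantes mod 2, leurs nombres
caractéristiques de Stiefel–Whitney sont égaux" (Pontryagin), and Thm. IV.9 / IV.12 with the list
of generators in small dimensions (pp. 76, 79–80): `𝔑⁴ ≅ ℤ₂ + ℤ₂`, detected by the Stiefel–Whitney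
numbers `w₄ = χ mod 2` and `w₁⁴`. By Wu's formula `w₁ = v₁` (Milnor–Stasheff 1974, Thm. 11.14),
`w₁⁴[M] = ⟨v₁⁴, [M]₂⟩` for the first Wu class `v₁ ∈ H¹(M; ℤ/2)` (`⟨v₁ ⌣ x, [M]₂⟩ = ⟨Sq¹ x, [M]₂⟩`
on `H³`), and it is in this bundle-free form that the number is treated here.

For closed topological `4`-manifolds `X : Type u` (compact, Hausdorff, charted on `ℝ⁴`) this file
DEFINES `wuNumberOnePowFour X = ⟨v₁ ⌣ v₁ ⌣ v₁ ⌣ v₁, [X]₂⟩ ∈ ℤ/2` (Wu classes and `[X]₂` from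
`WuClasses.lean`) and PROVES, with no named facts:

* `wuNumberOnePowFour_eq_of_homeomorph` — topological invariance;
* `modTwoFundamentalClass_sum`, `map_inl_wuClass_sum`, `map_inr_wuClass_sum` (every `n`, `k`) and
  `wuNumberOnePowFour_sum` — `[X ⊔ Y]₂ = inl_*[X]₂ + inr_*[Y]₂`, the Wu classes of a disjoint union
  restrict to those of the summands, and the number is additive;
* `wuNumberOnePowFour_boundary` — it vanishes on the boundary of every compact `5`-manifold with
  boundary (`kroneckerPairing_wuClass_one_pow_four_boundary`, `WuClassesBoundary.lean`: Thom's
  Thm. IV.3 for this number);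
* `wuNumberOnePowFour_eq_of_cobordism` — **`v₁⁴[M] = v₁⁴[N]` for cobordant closed 4-manifolds**
  (`Cobordism 4 M N`: `∂W ≅ M ⊔ N`, `BoundarySplitting.homeomorph`), hence
* `UnorientedBordismClass.wuNumberOnePowFour : 𝔑₄ → ℤ/2`, well defined on Thom's unoriented
  bordism group, additive (`…_add`) and zero on `0` (`…_zero`) — the second coordinate of Thom's
  isomorphism `𝔑₄ ≅ ℤ₂ + ℤ₂` (the first, `χ mod 2 = w₄ = w₂²`, is
  `UnorientedBordismClass.intCast_eulerChar_eq_zero_of_mk_eq_zero`, `BordismEulerParity.lean`).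

What is NOT here: a closed 4-manifold with `v₁⁴ ≠ 0` (`ℝℙ⁴`: needs `H*(ℝℙ⁴; ℤ/2)` and
`Sq¹(a³) = a⁴`), and the injectivity of `(χ mod 2, v₁⁴) : 𝔑₄ → (ℤ/2)²` (Thom's Thm. IV.10/IV.12,
the Pontryagin–Thom computation) — the remaining halves of
`Literature.Topology.FourManifolds.natCard_unorientedBordismClass_four`, in whose support this is written.

## References

* R. Thom, *Quelques propriétés globales des variétés différentiables*, Comment. Math. Helv. 28
  (1954), 17–86: Thm. IV.3 (p. 66), Thm. IV.9 (p. 76), Thm. IV.12 and pp. 79–80. [ThomCMH1954]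
* J. W. Milnor, J. D. Stasheff, *Characteristic Classes*, Ann. of Math. Studies 76 (1974), §4
  Thm. 4.9, §11 Thm. 11.14, §17. [MilnorStasheff1974]
-/

noncomputable section

open scoped Manifold ContDiff
open CategoryTheory Set Function
open Literature.AlgebraicTopology.SingularHomology
open Literature.AlgebraicTopology.SingularHomology.SingularSimplex (sumInl sumInr)

universe u

namespace Literature.Topology.FourManifolds

/-! ### The number `v₁⁴[X]` of a closed topological 4-manifold -/

section Number

variable (X : Type u) [TopologicalSpace X] [T2Space X] [CompactSpace X]
  [ChartedSpace (EuclideanSpace ℝ (Fin 4)) X]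

/-- The fourth cup power `v₁ ⌣ v₁ ⌣ v₁ ⌣ v₁ ∈ H⁴(X; ℤ/2)` of the first Wu class, bracketed as
`(v₁ ⌣ v₁) ⌣ (v₁ ⌣ v₁)`. [cite: MilnorStasheff1974, §11 p. 132] -/
def wuClassOnePowFour : singularCohomology (ZMod 2) (ZMod 2) X 4 :=
  cupProduct (show 2 + 2 = 4 by rfl)
    (cupProduct (show 1 + 1 = 2 by rfl) (wuClass X 4 1) (wuClass X 4 1))
    (cupProduct (show 1 + 1 = 2 by rfl) (wuClass X 4 1) (wuClass X 4 1))

/-- **The Wu number `v₁⁴[X] = ⟨v₁⁴, [X]₂⟩ ∈ ℤ/2`** of a closed topological 4-manifold — by Wu's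
formula `w₁ = v₁` this is the Stiefel–Whitney number `w₁⁴[X]` of Thom 1954, Thm. IV.9/IV.12 at
`k = 4` (that identification is not made here). [cite: ThomCMH1954, Thm. IV.9 and pp. 79–80] [cite: MilnorStasheff1974, §4 p. 50 (Stiefel–Whitney numbers), Thm. 11.14] -/
def wuNumberOnePowFour : ZMod 2 :=
  kroneckerPairing (ZMod 2) (ZMod 2) X 4 (wuClassOnePowFour X) (modTwoFundamentalClass X 4)

variable {X}

/-- `f^*` is multiplicative on the fourth power of `v₁`: if `f^* v₁(Y) = v₁(X)` then
`f^* v₁(Y)⁴ = v₁(X)⁴`. [cite: HatcherAT2002, §3.2 Prop. 3.10] -/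
theorem map_wuClassOnePowFour_of_map_wuClass {Y : Type u} [TopologicalSpace Y] [T2Space Y]
    [CompactSpace Y] [ChartedSpace (EuclideanSpace ℝ (Fin 4)) Y] (f : C(X, Y))
    (hf : singularCohomology.map (ZMod 2) (ZMod 2) f 1 (wuClass Y 4 1) = wuClass X 4 1) :
    singularCohomology.map (ZMod 2) (ZMod 2) f 4 (wuClassOnePowFour Y) = wuClassOnePowFour X := by
  simp only [wuClassOnePowFour, cupProduct_map, hf]

/-- **Topological invariance of `v₁⁴[X]`**: `v₁⁴[X] = v₁⁴[Y]` for homeomorphic closed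
4-manifolds (`e^* v₁(Y) = v₁(X)`, `e_* [X]₂ = [Y]₂`). [cite: ThomCMH1954, Thm. IV.3] -/
theorem wuNumberOnePowFour_eq_of_homeomorph {Y : Type u} [TopologicalSpace Y] [T2Space Y]
    [CompactSpace Y] [ChartedSpace (EuclideanSpace ℝ (Fin 4)) Y] (e : X ≃ₜ Y) :
    wuNumberOnePowFour X = wuNumberOnePowFour Y := by
  rw [wuNumberOnePowFour, wuNumberOnePowFour,
    ← map_wuClassOnePowFour_of_map_wuClass (e : C(X, Y)) (map_wuClass e 1), kroneckerPairing_map,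
    map_modTwoFundamentalClass e]

end Number

/-! ### Disjoint unions -/

section Sum

variable {n : ℕ} {X Y : Type u} [TopologicalSpace X] [T2Space X] [CompactSpace X]
  [ChartedSpace (EuclideanSpace ℝ (Fin n)) X] [TopologicalSpace Y] [T2Space Y] [CompactSpace Y]
  [ChartedSpace (EuclideanSpace ℝ (Fin n)) Y]

variable (n X Y) in
/-- **`[X ⊔ Y]₂ = inl_* [X]₂ + inr_* [Y]₂`** for closed `n`-manifolds (the mod-2 case of
`HomologicalOrientation.fundamentalClass_sum`, the sum orientation being THE `ℤ/2`-orientation).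
[cite: HatcherAT2002, §3.3 Thm. 3.26 and Lemma 3.27] -/
theorem modTwoFundamentalClass_sum :
    modTwoFundamentalClass (X ⊕ Y) n =
      singularHomology.map (ZMod 2) (ZMod 2) (sumInl X Y) n (modTwoFundamentalClass X n) +
        singularHomology.map (ZMod 2) (ZMod 2) (sumInr X Y) n (modTwoFundamentalClass Y n) := by
  obtain ⟨ξ, h₁, h₂⟩ := HomologicalOrientation.exists_sum (ZMod 2) (modTwoOrientation X n) (modTwoOrientation Y n)
  have h := HomologicalOrientation.fundamentalClass_sum (ZMod 2) (modTwoOrientation X n)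
    (modTwoOrientation Y n) ξ h₁ h₂
  rwa [ξ.eq_modTwoOrientation] at h

/-- **The Wu classes of a disjoint union restrict to those of the summands**:
`inl^* v_k(X ⊔ Y) = v_k(X)`.  For `x ∈ Hᵖ(X)` take `x̃ ∈ Hᵖ(X ⊔ Y)` with `inl^* x̃ = x`,
`inr^* x̃ = 0` (`Hᵖ(X ⊔ Y) ≅ Hᵖ(X) × Hᵖ(Y)`, `singularCohomology.sumEquiv`); then
`⟨inl^*v ⌣ x, [X]₂⟩ = ⟨v ⌣ x̃, inl_*[X]₂⟩ = ⟨v ⌣ x̃, [X ⊔ Y]₂⟩ - ⟨inr^*v ⌣ inr^*x̃, [Y]₂⟩ = ⟨Sqᵏ x̃, [X ⊔ Y]₂⟩`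
`= ⟨Sqᵏ x, [X]₂⟩ + ⟨Sqᵏ 0, [Y]₂⟩`, and the characterisation `eq_wuClass_of_forall` applies.
[cite: MilnorStasheff1974, §11 p. 132] -/
theorem map_inl_wuClass_sum (k : ℕ) :
    singularCohomology.map (ZMod 2) (ZMod 2) (sumInl X Y) k (wuClass (X ⊕ Y) n k) = wuClass X n k := by
  by_cases hkn : k ≤ n
  swap
  · rw [wuClass_eq_zero_of_lt' (not_le.1 hkn), wuClass_eq_zero_of_lt' (not_le.1 hkn), map_zero]
  obtain ⟨p, hp⟩ : ∃ p, p = n - k := ⟨_, rfl⟩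
  have h : k + p = n := by omega
  refine eq_wuClass_of_forall h fun x => ?_
  obtain ⟨xt, hxt⟩ := (singularCohomology.sumEquiv (ZMod 2) (ZMod 2) X Y p).surjective (x, 0)
  rw [singularCohomology.sumEquiv_apply, Prod.mk.injEq] at hxt
  obtain ⟨hx, hx0⟩ := hxt
  have hS := modTwoFundamentalClass_sum n X Y
  -- `⟨v ⌣ x̃, [X ⊔ Y]₂⟩ = ⟨Sqᵏ x̃, [X ⊔ Y]₂⟩`, split along the two summands
  have key := kroneckerPairing_wuClass_cupProduct (X := X ⊕ Y) h xt
  rw [hS, map_add, map_add, ← kroneckerPairing_map, ← kroneckerPairing_map, ← kroneckerPairing_map,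
    ← kroneckerPairing_map, cupProduct_map, cupProduct_map, steenrodSqLower_map, steenrodSqLower_map,
    hx, hx0] at key
  simp only [map_zero, LinearMap.zero_apply, add_zero] at key
  exact key

/-- `inr^* v_k(X ⊔ Y) = v_k(Y)` (swap the summands in `map_inl_wuClass_sum`). [cite: MilnorStasheff1974, §11 p. 132] -/
theorem map_inr_wuClass_sum (k : ℕ) :
    singularCohomology.map (ZMod 2) (ZMod 2) (sumInr X Y) k (wuClass (X ⊕ Y) n k) = wuClass Y n k := by
  by_cases hkn : k ≤ n
  swap
  · rw [wuClass_eq_zero_of_lt' (not_le.1 hkn), wuClass_eq_zero_of_lt' (not_le.1 hkn), map_zero]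
  obtain ⟨p, hp⟩ : ∃ p, p = n - k := ⟨_, rfl⟩
  have h : k + p = n := by omega
  refine eq_wuClass_of_forall h fun y => ?_
  obtain ⟨yt, hyt⟩ := (singularCohomology.sumEquiv (ZMod 2) (ZMod 2) X Y p).surjective (0, y)
  rw [singularCohomology.sumEquiv_apply, Prod.mk.injEq] at hyt
  obtain ⟨hy0, hy⟩ := hyt
  have hS := modTwoFundamentalClass_sum n X Y
  have key := kroneckerPairing_wuClass_cupProduct (X := X ⊕ Y) h yt
  rw [hS, map_add, map_add, ← kroneckerPairing_map, ← kroneckerPairing_map, ← kroneckerPairing_map,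
    ← kroneckerPairing_map, cupProduct_map, cupProduct_map, steenrodSqLower_map, steenrodSqLower_map,
    hy, hy0] at key
  simp only [map_zero, LinearMap.zero_apply, zero_add] at key
  exact key

end Sum

section SumFour

variable {X Y : Type u} [TopologicalSpace X] [T2Space X] [CompactSpace X]
  [ChartedSpace (EuclideanSpace ℝ (Fin 4)) X] [TopologicalSpace Y] [T2Space Y] [CompactSpace Y]
  [ChartedSpace (EuclideanSpace ℝ (Fin 4)) Y]

variable (X Y) in
/-- **Additivity: `v₁⁴[X ⊔ Y] = v₁⁴[X] + v₁⁴[Y]`** (Thom 1954, Ch. IV §1: characteristic numbers are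
additive under disjoint union). [cite: ThomCMH1954, Ch. IV §1 p. 64] -/
theorem wuNumberOnePowFour_sum :
    wuNumberOnePowFour (X ⊕ Y) = wuNumberOnePowFour X + wuNumberOnePowFour Y := by
  rw [wuNumberOnePowFour, modTwoFundamentalClass_sum 4 X Y, map_add, ← kroneckerPairing_map,
    ← kroneckerPairing_map, map_wuClassOnePowFour_of_map_wuClass _ (map_inl_wuClass_sum 1),
    map_wuClassOnePowFour_of_map_wuClass _ (map_inr_wuClass_sum 1)]
  rfl

/-- `v₁⁴[X] = 0` for an empty `X` (`H₄(∅) = 0`). [cite: ThomCMH1954, Ch. IV §1 p. 64] -/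
theorem wuNumberOnePowFour_of_isEmpty [IsEmpty X] : wuNumberOnePowFour X = 0 := by
  haveI := ModuleCat.subsingleton_of_isZero (isZero_singularHomology_of_isEmpty (ZMod 2) (ZMod 2) X 4)
  rw [wuNumberOnePowFour, Subsingleton.elim (modTwoFundamentalClass X 4) 0, map_zero]

end SumFour

/-! ### Boundaries and cobordisms -/

section Boundary

attribute [local instance] boundaryTopChartedSpace
attribute [local instance] compactSpace_boundary

/-- **`v₁⁴[∂W] = 0`** for every compact topological `5`-manifold with boundary `W` (Thom 1954,
Thm. IV.3 for this number; `kroneckerPairing_wuClass_one_pow_four_boundary`). [cite: ThomCMH1954, Thm. IV.3] -/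
theorem wuNumberOnePowFour_boundary (W : Type u) [TopologicalSpace W] [T2Space W] [CompactSpace W]
    [ChartedSpace (EuclideanHalfSpace (4 + 1)) W] :
    wuNumberOnePowFour ↥((𝓡∂ (4 + 1)).boundary W) = 0 :=
  kroneckerPairing_wuClass_one_pow_four_boundary

variable {M N : Type u} [TopologicalSpace M] [T2Space M] [CompactSpace M]
  [ChartedSpace (EuclideanSpace ℝ (Fin 4)) M] [TopologicalSpace N] [T2Space N] [CompactSpace N]
  [ChartedSpace (EuclideanSpace ℝ (Fin 4)) N]

/-- **Thom's Thm. IV.3 for the number `v₁⁴`: cobordant closed 4-manifolds have the same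
`v₁⁴[·]`.**  For a cobordism `W` from `M` to `N` (`Cobordism 4 M N`), `∂W ≅ M ⊔ N`
(`BoundarySplitting.homeomorph`), so `v₁⁴[M] + v₁⁴[N] = v₁⁴[M ⊔ N] = v₁⁴[∂W] = 0` in `ℤ/2`.
[cite: ThomCMH1954, Thm. IV.3 (p. 66)] -/
theorem wuNumberOnePowFour_eq_of_cobordism (c : Cobordism 4 M N) :
    wuNumberOnePowFour M = wuNumberOnePowFour N := by
  have e : M ⊕ N ≃ₜ ↥((𝓡∂ (4 + 1)).boundary c.W) := c.toBoundarySplitting.homeomorph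
  have h := wuNumberOnePowFour_eq_of_homeomorph e
  rw [wuNumberOnePowFour_boundary, wuNumberOnePowFour_sum] at h
  revert h
  generalize wuNumberOnePowFour M = a
  generalize wuNumberOnePowFour N = b
  revert a b
  decide

end Boundary

/-! ### Descent to Thom's group `𝔑₄` -/

section Bordism

/-- Bordant closed singular 4-manifolds (on the point) have equal `v₁⁴[·]`. [cite: ThomCMH1954, Thm. IV.3] -/
theorem ClosedSingularManifold.IsBordant.wuNumberOnePowFour_eq
    {s t : ClosedSingularManifold.{u} PUnit.{u + 1} 4} (h : s.IsBordant t) :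
    wuNumberOnePowFour s.M = wuNumberOnePowFour t.M := by
  obtain ⟨c, -, -, -⟩ := h
  exact wuNumberOnePowFour_eq_of_cobordism c

/-- **The homomorphism `v₁⁴[·] : 𝔑₄ → ℤ/2`** on Thom's unoriented bordism group (Thom 1954,
Thm. IV.3 makes it well defined; with `χ mod 2` it is the isomorphism `𝔑⁴ ≅ ℤ₂ + ℤ₂` of
Thm. IV.12, pp. 79–80 — surjectivity and injectivity are not proved here). [cite: ThomCMH1954, Thm. IV.3, Thm. IV.12] -/
def UnorientedBordismClass.wuNumberOnePowFour : UnorientedBordismClass.{u} 4 → ZMod 2 :=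
  Quot.lift (fun s => Literature.Topology.FourManifolds.wuNumberOnePowFour s.M)
    fun _ _ h => h.wuNumberOnePowFour_eq

/-- On representatives: `v₁⁴[[M, f]] = v₁⁴[M]`. [cite: ThomCMH1954, Thm. IV.3] -/
@[simp]
theorem UnorientedBordismClass.wuNumberOnePowFour_mk (s : ClosedSingularManifold.{u} PUnit.{u + 1} 4) :
    UnorientedBordismClass.wuNumberOnePowFour (BordismClass.mk s) =
      Literature.Topology.FourManifolds.wuNumberOnePowFour s.M :=
  rfl

/-- On closed smooth 4-manifolds: `v₁⁴[[M]] = v₁⁴[M]`. [cite: ThomCMH1954, Thm. IV.3] -/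
theorem UnorientedBordismClass.wuNumberOnePowFour_mk' (M : Type u) [TopologicalSpace M] [T2Space M]
    [ChartedSpace (EuclideanSpace ℝ (Fin 4)) M] [IsManifold (𝓡 4) ∞ M] [CompactSpace M] [BoundarylessManifold (𝓡 4) M] :
    UnorientedBordismClass.wuNumberOnePowFour (UnorientedBordismClass.mk M) =
      Literature.Topology.FourManifolds.wuNumberOnePowFour M :=
  rfl

/-- `v₁⁴[0] = 0` (the empty manifold). [cite: ThomCMH1954, Ch. IV §1] -/
theorem UnorientedBordismClass.wuNumberOnePowFour_zero :
    UnorientedBordismClass.wuNumberOnePowFour (0 : UnorientedBordismClass.{u} 4) = 0 :=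
  wuNumberOnePowFour_of_isEmpty

/-- **Additivity on `𝔑₄`**: `v₁⁴[a + b] = v₁⁴[a] + v₁⁴[b]` (addition = disjoint union of
representatives; the group structure of `𝔑₄` is unconditional, `bordismFacts_succ`).
[cite: ThomCMH1954, Ch. IV §1, Thm. IV.3] -/
theorem UnorientedBordismClass.wuNumberOnePowFour_add (a b : UnorientedBordismClass.{u} 4) :
    haveI := ClosedSingularManifold.bordismFacts_succ (Y := PUnit.{u + 1}) (n := 3)
    UnorientedBordismClass.wuNumberOnePowFour (a + b) =
      UnorientedBordismClass.wuNumberOnePowFour a + UnorientedBordismClass.wuNumberOnePowFour b := by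
  induction a using BordismClass.ind with | h s => ?_
  induction b using BordismClass.ind with | h t => ?_
  exact wuNumberOnePowFour_sum s.M t.M

end Bordism

end Literature.Topology.FourManifolds
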